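import Mathlib
import Summits.Ventures.PercRepro2.ThreeTermPartKernel
import Summits.Ventures.PercRepro2.ThreeTermPatternCone
import Summits.Ventures.PercRepro2.TypedStarCone

/-!
# Three-terminal parts, III: the typed base of core + part is the part's typed partition law
contracted with the part graph's table, and it is nonnegative on the Harris cone
(blind cell PercRepro2, night-3 g29, 2026-08-29; `proofs/NIGHT3-CERT.md` §38 — the gadget-law method
of §36.2 and the certificate of §37.6, for an ARBITRARY unmarked three-terminal part)

Setting as in ThreeTermPartKernel.lean: an unmarked three-terminal part `W` (`Part.IsPart`), its edges
`S` (all typed), the other typed edges `F`, the part graph `partEnds` with the three virtual edges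
`e₁ = {t₁, t₂}`, `e₂ = {t₁, t₃}`, `e₃ = {t₂, t₃}`.  A part configuration `a` (supported on `S`) has the
PATTERN `pat a : Fin 8` — the bits are the three observables «`tᵢ ↔ tⱼ` inside `S`» — and the part map
`pm a` is the star configuration `cfg e₁ e₂ e₃ (pat a)` of the virtual edges (`pm_eq_cfg_pat`).

* **`partLaw S τ pat i j k`** — the part's TYPED PARTITION LAW: the number of typed triples of part
  configurations (open counts `τ` on `S`) with patterns `(i, j, k)` in the three copies; it is
  copy-symmetric (`partLaw_sym`) and nonnegative;
* **`partTable`** — the part graph's per-copy pinned table at the pattern configurations;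
* **`typedCount_part_eq`** (THE GADGET LAW): `typedCount (F ∪ S) z τ K₃ = Σ_{i j k} partLaw i j k ·
  partTable i j k` — the typed base of core + part is the part's law contracted with the core's table
  (`typedCount_split` + `typedCount3_part` + regrouping by patterns, `sum_regroup`);
* `πpat` — the partition map of the pattern world (`1 ↦ 01`, `2 ↦ 02`, `4 ↦ 12`, two or three bits
  `↦ ⊤`, `0 ↦ ⊥`), the `π` of the Harris cone `InConeP` of ThreeTermPatternCone.lean;
* **`typedCount_part_nonneg`** (THE THEOREM): if the part graph's table lies in the Harris cone of the
  pattern world and the part's typed partition law satisfies the typed Harris condition, the typed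
  base of core + part is nonnegative — row 2′TRI for core + ANY three-terminal part from one
  certificate on the core's table and one finite check on the part's law (§37.6, now for every part,
  not only the `(2,2,2)`-star of `TypedStarCone.typedCount_star222_nonneg`).

Own work; standard axioms.
-/

namespace Summit.Ventures.PercRepro2

open Block ThreeTerm TypedStar

namespace Part

/-! ## The pattern of a part configuration and the part's typed law -/

section PartLaw

variable {V : Type*} {E : Type*} [Fintype E] [DecidableEq E]

/-- The partition map of the pattern world: bit `0` = `t₁ ↔ t₂` (`01`), bit `1` = `t₁ ↔ t₃` (`02`),
bit `2` = `t₂ ↔ t₃` (`12`); two or three bits merge everything (`⊤`). -/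
def πpat : Fin 8 → Fin 5 := fun i =>
  if i.val = 0 then 0 else if i.val = 1 then 1 else if i.val = 2 then 2 else if i.val = 4 then 3 else 4

/-- The pattern of a part configuration: the bits of its part map on the virtual edges. -/
noncomputable def pat (ends : E → Sym2 V) (S : Finset E) (e₁ e₂ e₃ : E) (t₁ t₂ t₃ : V) (a : Config E) :
    Fin 8 :=
  bits e₁ e₂ e₃ (pm ends (↑S) e₁ e₂ e₃ t₁ t₂ t₃ a)

omit [Fintype E] in
/-- The part map of a configuration supported on `S` is supported on the virtual edges. -/
lemma suppOn_pm (ends : E → Sym2 V) (S : Finset E) {e₁ e₂ e₃ : E} (h1 : e₁ ∈ S) (h2 : e₂ ∈ S)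
    (h3 : e₃ ∈ S) (t₁ t₂ t₃ : V) {a : Config E} (ha : SuppOn S a) :
    SuppOn {e₁, e₂, e₃} (pm ends (↑S) e₁ e₂ e₃ t₁ t₂ t₃ a) := by
  intro e he
  by_contra hne
  simp only [Finset.mem_insert, Finset.mem_singleton, not_or] at hne
  by_cases heS : e ∈ S
  · rw [pm, partMap_apply_of_mem (↑S) _ _ _ a hne.1 hne.2.1 hne.2.2 (Finset.mem_coe.2 heS)] at he
    exact Bool.false_ne_true he
  · rw [pm_of_notMem ends (↑S) (Finset.mem_coe.2 h1) (Finset.mem_coe.2 h2) (Finset.mem_coe.2 h3) t₁ t₂ t₃ a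
      (fun h => heS (Finset.mem_coe.1 h))] at he
    exact heS (ha e he)

omit [Fintype E] in
/-- **The part map is the star configuration of the pattern.** -/
lemma pm_eq_cfg_pat (ends : E → Sym2 V) (S : Finset E) {e₁ e₂ e₃ : E} (h1 : e₁ ∈ S) (h2 : e₂ ∈ S)
    (h3 : e₃ ∈ S) (h12 : e₁ ≠ e₂) (h13 : e₁ ≠ e₃) (h23 : e₂ ≠ e₃) (t₁ t₂ t₃ : V) {a : Config E}
    (ha : SuppOn S a) :
    pm ends (↑S) e₁ e₂ e₃ t₁ t₂ t₃ a = cfg e₁ e₂ e₃ (pat ends S e₁ e₂ e₃ t₁ t₂ t₃ a) :=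
  (cfg_bits e₁ e₂ e₃ h12 h13 h23 (suppOn_pm ends S h1 h2 h3 t₁ t₂ t₃ ha)).symm

/-- **The part's typed partition law**: the number of typed triples of part configurations with
patterns `(i, j, k)`. -/
noncomputable def partLaw (S : Finset E) (τ : E → ℕ) (pat : Config E → Fin 8) (i j k : Fin 8) : ℚ :=
  ∑ a : Config E, ∑ b : Config E, ∑ c : Config E,
    if ((SuppOn S a ∧ SuppOn S b ∧ SuppOn S c) ∧ (∀ e ∈ S, openCount a b c e = τ e)) ∧
        (pat a = i ∧ pat b = j ∧ pat c = k) then 1 else 0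

/-- The part's law is nonnegative. -/
lemma partLaw_nonneg (S : Finset E) (τ : E → ℕ) (pat : Config E → Fin 8) (i j k : Fin 8) :
    0 ≤ partLaw S τ pat i j k := by
  unfold partLaw
  refine Finset.sum_nonneg fun a _ => Finset.sum_nonneg fun b _ => Finset.sum_nonneg fun c _ => ?_
  split_ifs <;> norm_num

omit [Fintype E] [DecidableEq E] in
/-- The open count is symmetric in the first two copies. -/
lemma openCount_swap12 (a b c : Config E) (e : E) : openCount a b c e = openCount b a c e := by
  simp only [openCount]; ring

omit [Fintype E] [DecidableEq E] in
/-- The open count is symmetric in the last two copies. -/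
lemma openCount_swap23 (a b c : Config E) (e : E) : openCount a b c e = openCount a c b e := by
  simp only [openCount]; ring

/-- The part's law is copy-symmetric. -/
lemma partLaw_sym (S : Finset E) (τ : E → ℕ) (pat : Config E → Fin 8) : Sym3 (partLaw S τ pat) where
  swap12 := by
    intro i j k
    unfold partLaw
    rw [Finset.sum_comm]
    refine Finset.sum_congr rfl fun b _ => Finset.sum_congr rfl fun a _ => Finset.sum_congr rfl fun c _ => ?_
    simp only [openCount_swap12 a b c]
    by_cases h : ((SuppOn S a ∧ SuppOn S b ∧ SuppOn S c) ∧ ∀ e ∈ S, openCount b a c e = τ e) ∧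
        pat a = i ∧ pat b = j ∧ pat c = k
    · rw [if_pos h, if_pos ⟨⟨⟨h.1.1.2.1, h.1.1.1, h.1.1.2.2⟩, h.1.2⟩, h.2.2.1, h.2.1, h.2.2.2⟩]
    · rw [if_neg h, if_neg (fun h' => h ⟨⟨⟨h'.1.1.2.1, h'.1.1.1, h'.1.1.2.2⟩, h'.1.2⟩, h'.2.2.1, h'.2.1,
        h'.2.2.2⟩)]
  swap23 := by
    intro i j k
    unfold partLaw
    refine Finset.sum_congr rfl fun a _ => ?_
    rw [Finset.sum_comm]
    refine Finset.sum_congr rfl fun c _ => Finset.sum_congr rfl fun b _ => ?_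
    simp only [openCount_swap23 a b c]
    by_cases h : ((SuppOn S a ∧ SuppOn S b ∧ SuppOn S c) ∧ ∀ e ∈ S, openCount a c b e = τ e) ∧
        pat a = i ∧ pat b = j ∧ pat c = k
    · rw [if_pos h, if_pos ⟨⟨⟨h.1.1.1, h.1.1.2.2, h.1.1.2.1⟩, h.1.2⟩, h.2.1, h.2.2.2, h.2.2.1⟩]
    · rw [if_neg h, if_neg (fun h' => h ⟨⟨⟨h'.1.1.1, h'.1.1.2.2, h'.1.1.2.1⟩, h'.1.2⟩, h'.2.1, h'.2.2.2,
        h'.2.2.1⟩)]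

end PartLaw

/-! ## Regrouping a triple sum by patterns -/

section Regroup

variable {E : Type*} [Fintype E] [DecidableEq E]

/-- A triple sum over `Fin 8` of a fibre indicator collapses. -/
lemma sum_pat_collapse (g : Fin 8 → Fin 8 → Fin 8 → ℚ) (i j k : Fin 8) :
    (∑ i' : Fin 8, ∑ j' : Fin 8, ∑ k' : Fin 8, if i = i' ∧ j = j' ∧ k = k' then g i' j' k' else 0) =
      g i j k := by
  rw [Fintype.sum_eq_single i (fun i' hi => Finset.sum_eq_zero fun j' _ => Finset.sum_eq_zero fun k' _ =>
    by simp [Ne.symm hi])]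
  rw [Fintype.sum_eq_single j (fun j' hj => Finset.sum_eq_zero fun k' _ => by simp [Ne.symm hj])]
  rw [Fintype.sum_eq_single k (fun k' hk => by simp [Ne.symm hk])]
  simp

/-- Commuting three outer sums past three inner sums. -/
lemma sum6_comm {A B C I J K : Type*} [Fintype A] [Fintype B] [Fintype C] [Fintype I] [Fintype J]
    [Fintype K] (f : A → B → C → I → J → K → ℚ) :
    (∑ a, ∑ b, ∑ c, ∑ i, ∑ j, ∑ k, f a b c i j k) = ∑ i, ∑ j, ∑ k, ∑ a, ∑ b, ∑ c, f a b c i j k :=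
  calc (∑ a, ∑ b, ∑ c, ∑ i, ∑ j, ∑ k, f a b c i j k)
      = ∑ u : A × B × C, ∑ y : I × J × K, f u.1 u.2.1 u.2.2 y.1 y.2.1 y.2.2 := by
        simp only [Fintype.sum_prod_type]
    _ = ∑ y : I × J × K, ∑ u : A × B × C, f u.1 u.2.1 u.2.2 y.1 y.2.1 y.2.2 := Finset.sum_comm
    _ = ∑ i, ∑ j, ∑ k, ∑ a, ∑ b, ∑ c, f a b c i j k := by
        simp only [Fintype.sum_prod_type]

/-- **Regrouping by patterns**: a conditioned triple sum of `g ∘ pat` is the contraction of the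
pattern counts with `g`. -/
lemma sum_regroup (C : Config E → Config E → Config E → Prop) [∀ a b c, Decidable (C a b c)]
    (pat : Config E → Fin 8) (g : Fin 8 → Fin 8 → Fin 8 → ℚ) :
    (∑ a : Config E, ∑ b : Config E, ∑ c : Config E, if C a b c then g (pat a) (pat b) (pat c) else 0) =
      ∑ i : Fin 8, ∑ j : Fin 8, ∑ k : Fin 8,
        (∑ a : Config E, ∑ b : Config E, ∑ c : Config E,
          if C a b c ∧ (pat a = i ∧ pat b = j ∧ pat c = k) then 1 else 0) * g i j k := by
  have step : ∀ a b c : Config E, (if C a b c then g (pat a) (pat b) (pat c) else 0) =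
      ∑ i : Fin 8, ∑ j : Fin 8, ∑ k : Fin 8,
        (if C a b c ∧ (pat a = i ∧ pat b = j ∧ pat c = k) then 1 else 0) * g i j k := by
    intro a b c
    by_cases h : C a b c
    · rw [if_pos h, ← sum_pat_collapse g (pat a) (pat b) (pat c)]
      refine Finset.sum_congr rfl fun i _ => Finset.sum_congr rfl fun j _ => Finset.sum_congr rfl fun k _ => ?_
      simp only [h, true_and, boole_mul]
    · rw [if_neg h]
      symm
      refine Finset.sum_eq_zero fun i _ => Finset.sum_eq_zero fun j _ => Finset.sum_eq_zero fun k _ => ?_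
      simp [h]
  simp only [step]
  rw [sum6_comm]
  refine Finset.sum_congr rfl fun i _ => Finset.sum_congr rfl fun j _ => Finset.sum_congr rfl fun k _ => ?_
  rw [Finset.sum_mul]
  refine Finset.sum_congr rfl fun a _ => ?_
  rw [Finset.sum_mul]
  refine Finset.sum_congr rfl fun b _ => ?_
  rw [Finset.sum_mul]

end Regroup

/-! ## The gadget law and the theorem -/

section Main

variable {V : Type*} {E : Type*} [Fintype E] [DecidableEq E]

/-- **The part graph's table**: the per-copy pinned count of the part graph at the pattern
configurations of the virtual edges. -/
noncomputable def partTable (ends : E → Sym2 V) (S : Finset E) (e₁ e₂ e₃ : E) (t₁ t₂ t₃ : V)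
    (o a₁ a₂ a₃ b : V) (F : Finset E) (z : Config E) (τ : E → ℕ) (i j k : Fin 8) : ℚ :=
  typedCount3 F (setOn S (cfg e₁ e₂ e₃ i) z) (setOn S (cfg e₁ e₂ e₃ j) z) (setOn S (cfg e₁ e₂ e₃ k) z) τ
    (CovForm.K3 (R := ℚ) (partEnds ends (↑S) e₁ e₂ e₃ t₁ t₂ t₃) o a₁ a₂ a₃ b)

/-- **THE GADGET LAW**: the typed base of core + part is the part's typed partition law contracted
with the part graph's table. -/
theorem typedCount_part_eq {ends : E → Sym2 V} {W : Set V} {t₁ t₂ t₃ : V}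
    (hW : IsPart ends W t₁ t₂ t₃) {S : Finset E} (hS : ∀ e, e ∈ S ↔ e ∈ touches ends W)
    {e₁ e₂ e₃ : E} (h1 : e₁ ∈ S) (h2 : e₂ ∈ S) (h3 : e₃ ∈ S) (h12 : e₁ ≠ e₂) (h13 : e₁ ≠ e₃)
    (h23 : e₂ ≠ e₃) {o a₁ a₂ a₃ b : V} (ho : o ∉ W) (ha₁ : a₁ ∉ W) (ha₂ : a₂ ∉ W) (ha₃ : a₃ ∉ W)
    (hb : b ∉ W) {F : Finset E} (hd : Disjoint F S) (z : Config E) (τ : E → ℕ) :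
    typedCount (F ∪ S) z τ (CovForm.K3 (R := ℚ) ends o a₁ a₂ a₃ b) =
      ∑ i : Fin 8, ∑ j : Fin 8, ∑ k : Fin 8,
        partLaw S τ (pat ends S e₁ e₂ e₃ t₁ t₂ t₃) i j k *
          partTable ends S e₁ e₂ e₃ t₁ t₂ t₃ o a₁ a₂ a₃ b F z τ i j k := by
  rw [typedCount_split hd]
  -- each term is the part graph's table at the patterns
  have step : ∀ a b' c : Config E,
      (if (SuppOn S a ∧ SuppOn S b' ∧ SuppOn S c) ∧ (∀ e ∈ S, openCount a b' c e = τ e) then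
        typedCount3 F (setOn S a z) (setOn S b' z) (setOn S c z) τ (CovForm.K3 (R := ℚ) ends o a₁ a₂ a₃ b)
      else 0) =
      (if (SuppOn S a ∧ SuppOn S b' ∧ SuppOn S c) ∧ (∀ e ∈ S, openCount a b' c e = τ e) then
        partTable ends S e₁ e₂ e₃ t₁ t₂ t₃ o a₁ a₂ a₃ b F z τ (pat ends S e₁ e₂ e₃ t₁ t₂ t₃ a)
          (pat ends S e₁ e₂ e₃ t₁ t₂ t₃ b') (pat ends S e₁ e₂ e₃ t₁ t₂ t₃ c) else 0) := by
    intro a b' c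
    by_cases h : (SuppOn S a ∧ SuppOn S b' ∧ SuppOn S c) ∧ (∀ e ∈ S, openCount a b' c e = τ e)
    · rw [if_pos h, if_pos h]
      rw [typedCount3_part hW hS h1 h2 h3 h12 h13 h23 ho ha₁ ha₂ ha₃ hb hd z τ a b' c]
      unfold partTable
      rw [pm_eq_cfg_pat ends S h1 h2 h3 h12 h13 h23 t₁ t₂ t₃ h.1.1,
        pm_eq_cfg_pat ends S h1 h2 h3 h12 h13 h23 t₁ t₂ t₃ h.1.2.1,
        pm_eq_cfg_pat ends S h1 h2 h3 h12 h13 h23 t₁ t₂ t₃ h.1.2.2]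
    · rw [if_neg h, if_neg h]
  simp only [step]
  rw [sum_regroup]
  rfl

/-- **THE THEOREM — row 2′TRI for core + any three-terminal part from the Harris cone**: if the part
graph's table lies in the Harris cone of the pattern world and the part's typed partition law satisfies
the typed Harris condition, the typed base of core + part is nonnegative. -/
theorem typedCount_part_nonneg {ends : E → Sym2 V} {W : Set V} {t₁ t₂ t₃ : V}
    (hW : IsPart ends W t₁ t₂ t₃) {S : Finset E} (hS : ∀ e, e ∈ S ↔ e ∈ touches ends W)
    {e₁ e₂ e₃ : E} (h1 : e₁ ∈ S) (h2 : e₂ ∈ S) (h3 : e₃ ∈ S) (h12 : e₁ ≠ e₂) (h13 : e₁ ≠ e₃)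
    (h23 : e₂ ≠ e₃) {o a₁ a₂ a₃ b : V} (ho : o ∉ W) (ha₁ : a₁ ∉ W) (ha₂ : a₂ ∉ W) (ha₃ : a₃ ∉ W)
    (hb : b ∉ W) {F : Finset E} (hd : Disjoint F S) (z : Config E) (τ : E → ℕ)
    (hcone : InConeP πpat (cubicOf (partTable ends S e₁ e₂ e₃ t₁ t₂ t₃ o a₁ a₂ a₃ b F z τ)))
    (hH : TypedHarris πpat (partLaw S τ (pat ends S e₁ e₂ e₃ t₁ t₂ t₃))) :
    0 ≤ typedCount (F ∪ S) z τ (CovForm.K3 (R := ℚ) ends o a₁ a₂ a₃ b) := by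
  rw [typedCount_part_eq hW hS h1 h2 h3 h12 h13 h23 ho ha₁ ha₂ ha₃ hb hd z τ]
  have hsym := partLaw_sym S τ (pat ends S e₁ e₂ e₃ t₁ t₂ t₃)
  have := lawSum_nonneg_of_inConeP πpat hsym (partLaw_nonneg S τ _) hH hcone
  rwa [lawSum_cubicOf hsym] at this

end Main

end Part

end Summit.Ventures.PercRepro2
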